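import Summits.QuantumFields.BalabanUV.Beta.D1BFx.LatticeHLSPairing

/-!
# `BalabanUV.Beta.D1BFx.LatticeHLSDamped` — road «BF-x» for binder row D1, letter (L5) «GN-L5 HLS KIT», PART 5: DAMPED PROFILES IN, DAMPED PROFILES OUT —
# the kit's two-profile sums and `pairing`∕`applyK` bounds WITH THE SCALE-`n` EXPONENTIAL DAMPING KEPT ON THE OUTPUT (decay in the distance of the
# two centres), plus the FLAT × COULOMB and FLAT × FLAT damped sums that the block-smooth projector letters produce (needed by the `dip`∕`ndl` cells of T₃)

HONEST FRAMING (cell contract, verbatim): «discharging `BetaPertH` makes Bałaban's UV stability UNCONDITIONAL — a real constructive-QFT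
result; it is NOT the continuum limit and NOT the Clay problem.»  HONEST DEPENDENCY (verbatim): «continuum YM on T⁴ ⇐ BetaPertH ∧ nine
spine estimates (0/9 proved); BetaPertH ⇐ (D1) ∧ (D4) ∧ CAP+tail; G-an2-4 gates asym, D1 and NE2/3/4.»  THIS MODULE DISCHARGES NOTHING
of D1 ∕ BetaPertH: it is [folklore] bookkeeping — one triangle inequality in the exponent — over parts 1–4 of the kit (`LatticeHLSRadial`,
`LatticeHLS`, `LatticeHLSProfiles`, `LatticeHLSPairing`); `K`, `f`, `A`, `φ`, `ψ`, `χ` are ARBITRARY; nothing of Bałaban's is asserted; 0 binders;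
(K) NOT closed; NOT D1, NOT BetaPertH, NOT continuum, NOT Clay.
WHY (owner RULING ρ-g10-5 (a) «GN-33∕KK → leaf-04-g9»; an3-g57 §3′ (4) R2⊗R2 «× partner sum `Σ_{b′}|w|²e^{−δ·bd} ≍ n⁶`»): in the `dip ⊗ dip` cell every
factor of every pairing carries a scale-`n` damping (`Ga`: `GluonLegProfile`, the R-column: `RColumnProfile`'s `e^{−(dR∕2∕n)‖x−s‖}`, the projector:
`ProjectorSupNorm`'s block decay), and the (1.22) partner sum converges ONLY because the product of two pairings inherits a damping
`e^{−(ε∕n)‖w‖∞}` in the bond separation `w`.  Parts 3–4 of the kit drop the damping on the output; this part keeps it: for three damped factors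
centred at `u`, `·`, `v` the triangle inequality `‖u−v‖∞ ≤ ‖x−u‖∞ + ‖x−v‖∞` turns the product of the dampings into `e^{−ε‖u−v‖∞}` times
undamped (or half-damped) profiles, to which parts 1–4 apply verbatim.
CONTENT (all [folklore]; `C_d := d·2^{d+3}·9^{d−1}`, `κ_d := 2d·3^{d−1}`).  §1 the exponent bookkeeping (`exp_mul_exp_le_exp_of_triangle`, the half split);
§2 COULOMB × COULOMB damped (`a, b ≤ d−1`, `a+b ≥ d+1`): `abs_sum_mul_le_of_damped_profiles` — `Σ_{x∈S}|K x·f x| ≤ κA·C_d·e^{−ε‖u−v‖∞}∕nrm(u−v)^{a+b−d}`,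
`tsum`∕`Summable` form, `abs_applyK_le_of_damped_profiles` (DAMPED PROFILE IN → DAMPED PROFILE OUT: `|applyK A φ x c| ≤ card F·κB·C_d·e^{−ε‖x−u‖∞}∕nrm(x−u)^{a+b−d}`),
`abs_pairing_le_of_damped_profiles`; §3 FLAT × COULOMB damped (`a ≤ d−1`, the flat factor of size `B`): `abs_sum_mul_le_of_damped_flat` —
`Σ_{x∈S}|K x·f x| ≤ κB·e^{−(ε∕2)‖u−v‖∞}·(1 + κ_d(d−1−a)!(4∕ε)^{d−1−a}(1+4∕ε))` (at `ε = δ∕n`: `C·n^{d−a}`), `abs_applyK_le_of_damped_flat`,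
`abs_pairing_le_of_damped_flat`; §4 FLAT × FLAT damped: `abs_sum_mul_le_of_flat_flat` (`≤ κB·e^{−(ε∕2)‖u−v‖∞}·(1 + κ_d(d−1)!(4∕ε)^{d−1}(1+4∕ε))`, `C·n^d`).
Unit `b2b-balaban-beta-d1-formalise-leaf-04` (gen 9), «GN-33∕KK» letters layer (journal 2026-08-21 ≈l.30555).
-/

namespace Summit.QuantumFields.BalabanUV.Beta.D1BFx.LatticeHLSDamped

open Finset
open scoped BigOperators
open Literature.MathematicalPhysics.QuantumFieldTheory.Balaban1983to89.Beta
open ExpKernelCalculus (Site MKer)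
open PoissonInterior (supNorm nrm nrm_pos nrm_neg supNorm_neg supNorm_add_le)
open LatticeHLSRadial (sum_exp_div_nrm_pow_le)
open LatticeHLS (sum_inv_nrm_pow_mul_le)
open LatticeHLSProfiles (summable_and_abs_tsum_le_of_abs_sum_le)
open LatticeHLSPairing (abs_sum_fibre_mul_le)
open RankOneBubble (pairing applyK pairing_def applyK_apply)

variable {d : ℕ} {F : Type*} [Fintype F]

/-! ## §1 Exponent bookkeeping -/

/-- [folklore] **THE TRIANGLE INEQUALITY IN THE EXPONENT**: for `ε ≥ 0`,
`e^{−ε‖x−u‖∞}·e^{−ε‖x−v‖∞} ≤ e^{−ε‖u−v‖∞}` (`‖u−v‖∞ ≤ ‖x−u‖∞ + ‖x−v‖∞`). -/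
theorem exp_mul_exp_le_exp_of_triangle {ε : ℝ} (hε : 0 ≤ ε) (x u v : Site d) :
    Real.exp (-ε * supNorm (x - u)) * Real.exp (-ε * supNorm (x - v)) ≤ Real.exp (-ε * supNorm (u - v)) := by
  rw [← Real.exp_add]
  apply Real.exp_le_exp.mpr
  have h : supNorm (u - v) ≤ supNorm (x - u) + supNorm (x - v) := by
    have := supNorm_add_le (u - x) (x - v)
    rwa [show u - x + (x - v) = u - v by abel, show u - x = -(x - u) by abel, supNorm_neg] at this
  have h' : (supNorm (u - v) : ℝ) ≤ supNorm (x - u) + supNorm (x - v) := by exact_mod_cast h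
  nlinarith

/-- [folklore] The half split `e^{−εt} = e^{−(ε∕2)t}·e^{−(ε∕2)t}`. -/
theorem exp_neg_eq_half_mul_half (ε t : ℝ) : Real.exp (-ε * t) = Real.exp (-(ε / 2) * t) * Real.exp (-(ε / 2) * t) := by
  rw [← Real.exp_add]; congr 1; ring

/-! ## §2 Coulomb × Coulomb, damped: the damping moves to the two centres -/

/-- [folklore] **TWO DAMPED PROFILES, SUPER-CRITICAL** (`a, b ≤ d−1`, `a+b ≥ d+1`; `κ, A ≥ 0`, `ε ≥ 0`): if `|K x| ≤ κ·e^{−ε‖x−u‖∞}∕nrm(x−u)^a` and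
`|f x| ≤ A·e^{−ε‖x−v‖∞}∕nrm(x−v)^b` on `S` then `Σ_{x∈S}|K x·f x| ≤ κ·A·(d·2^{d+3}·9^{d−1})·e^{−ε‖u−v‖∞}∕nrm(u−v)^{a+b−d}` — part 2's HLS sum with the
product of the two dampings turned into the damping of the centre distance. -/
theorem abs_sum_mul_le_of_damped_profiles (hd : 0 < d) {a b : ℕ} (ha : a ≤ d - 1) (hb : b ≤ d - 1) (hab : d + 1 ≤ a + b)
    {K f : Site d → ℝ} {κ A ε : ℝ} (hκ : 0 ≤ κ) (hA : 0 ≤ A) (hε : 0 ≤ ε) (S : Finset (Site d)) (u v : Site d)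
    (hK : ∀ x ∈ S, |K x| ≤ κ * Real.exp (-ε * supNorm (x - u)) / nrm (x - u) ^ a)
    (hf : ∀ x ∈ S, |f x| ≤ A * Real.exp (-ε * supNorm (x - v)) / nrm (x - v) ^ b) :
    ∑ x ∈ S, |K x * f x| ≤ κ * A * (d * 2 ^ (d + 3) * 9 ^ (d - 1)) * Real.exp (-ε * supNorm (u - v)) / nrm (u - v) ^ (a + b - d) := by
  have hpt : ∀ x ∈ S, |K x * f x| ≤ κ * A * Real.exp (-ε * supNorm (u - v)) * (1 / (nrm (x - u) ^ a * nrm (x - v) ^ b)) := by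
    intro x hx
    have h1 := nrm_pos (x - u); have h2 := nrm_pos (x - v)
    have htri := exp_mul_exp_le_exp_of_triangle hε x u v
    rw [abs_mul]
    calc |K x| * |f x| ≤ κ * Real.exp (-ε * supNorm (x - u)) / nrm (x - u) ^ a * (A * Real.exp (-ε * supNorm (x - v)) / nrm (x - v) ^ b) :=
          mul_le_mul (hK x hx) (hf x hx) (abs_nonneg _) (by positivity)
      _ = κ * A * (Real.exp (-ε * supNorm (x - u)) * Real.exp (-ε * supNorm (x - v))) * (1 / (nrm (x - u) ^ a * nrm (x - v) ^ b)) := by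
          field_simp
      _ ≤ κ * A * Real.exp (-ε * supNorm (u - v)) * (1 / (nrm (x - u) ^ a * nrm (x - v) ^ b)) := by gcongr
  calc ∑ x ∈ S, |K x * f x| ≤ ∑ x ∈ S, κ * A * Real.exp (-ε * supNorm (u - v)) * (1 / (nrm (x - u) ^ a * nrm (x - v) ^ b)) :=
        Finset.sum_le_sum hpt
    _ = κ * A * Real.exp (-ε * supNorm (u - v)) * ∑ x ∈ S, 1 / (nrm (x - u) ^ a * nrm (x - v) ^ b) := by rw [Finset.mul_sum]
    _ ≤ κ * A * Real.exp (-ε * supNorm (u - v)) * (d * 2 ^ (d + 3) * 9 ^ (d - 1) / nrm (u - v) ^ (a + b - d)) :=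
        mul_le_mul_of_nonneg_left (sum_inv_nrm_pow_mul_le hd ha hb hab S u v) (by positivity)
    _ = _ := by ring

/-- [folklore] `Summable` ∕ `tsum` form of `abs_sum_mul_le_of_damped_profiles` (profiles on all of `ℤ^d`). -/
theorem abs_tsum_mul_le_of_damped_profiles (hd : 0 < d) {a b : ℕ} (ha : a ≤ d - 1) (hb : b ≤ d - 1) (hab : d + 1 ≤ a + b)
    {K f : Site d → ℝ} {κ A ε : ℝ} (hκ : 0 ≤ κ) (hA : 0 ≤ A) (hε : 0 ≤ ε) (u v : Site d)
    (hK : ∀ x, |K x| ≤ κ * Real.exp (-ε * supNorm (x - u)) / nrm (x - u) ^ a)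
    (hf : ∀ x, |f x| ≤ A * Real.exp (-ε * supNorm (x - v)) / nrm (x - v) ^ b) :
    Summable (fun x => K x * f x) ∧
      |∑' x, K x * f x| ≤ κ * A * (d * 2 ^ (d + 3) * 9 ^ (d - 1)) * Real.exp (-ε * supNorm (u - v)) / nrm (u - v) ^ (a + b - d) :=
  summable_and_abs_tsum_le_of_abs_sum_le fun S =>
    abs_sum_mul_le_of_damped_profiles hd ha hb hab hκ hA hε S u v (fun x _ => hK x) (fun x _ => hf x)

/-- [folklore] **DAMPED PROFILE IN → DAMPED PROFILE OUT** (`a, b ≤ d−1`, `a+b ≥ d+1`): a damped entry profile of the leg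
`|A x y c e| ≤ κ·e^{−ε‖x−y‖∞}∕nrm(x−y)^a` and a damped profile `|φ y e| ≤ B·e^{−ε‖y−u‖∞}∕nrm(y−u)^b` give, at EVERY `x`, `c`,
`|applyK A φ x c| ≤ card F·κ·B·(d·2^{d+3}·9^{d−1})·e^{−ε‖x−u‖∞}∕nrm(x−u)^{a+b−d}` — a damped profile again, so the bound COMPOSES along a word. -/
theorem abs_applyK_le_of_damped_profiles (hd : 0 < d) {a b : ℕ} (ha : a ≤ d - 1) (hb : b ≤ d - 1) (hab : d + 1 ≤ a + b)
    {A : MKer d F} {φ : Site d → F → ℝ} {κ B ε : ℝ} (hκ : 0 ≤ κ) (hB : 0 ≤ B) (hε : 0 ≤ ε) (u : Site d)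
    (hA : ∀ x y c e, |A x y c e| ≤ κ * Real.exp (-ε * supNorm (x - y)) / nrm (x - y) ^ a)
    (hφ : ∀ y e, |φ y e| ≤ B * Real.exp (-ε * supNorm (y - u)) / nrm (y - u) ^ b) (x : Site d) (c : F) :
    |applyK A φ x c| ≤ Fintype.card F * κ * B * (d * 2 ^ (d + 3) * 9 ^ (d - 1)) * Real.exp (-ε * supNorm (x - u)) / nrm (x - u) ^ (a + b - d) := by
  rw [applyK_apply]
  have hS : ∀ S : Finset (Site d), ∑ y ∈ S, |∑ e, A x y c e * φ y e|
      ≤ Fintype.card F * κ * B * (d * 2 ^ (d + 3) * 9 ^ (d - 1)) * Real.exp (-ε * supNorm (x - u)) / nrm (x - u) ^ (a + b - d) := by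
    intro S
    have hpt : ∀ y ∈ S, |∑ e, A x y c e * φ y e| ≤ Fintype.card F *
        (κ * Real.exp (-ε * supNorm (y - x)) / nrm (y - x) ^ a * (B * Real.exp (-ε * supNorm (y - u)) / nrm (y - u) ^ b)) := by
      intro y _
      have := nrm_pos (y - x)
      refine abs_sum_fibre_mul_le (ψ := fun y e => A x y c e) (P := κ * Real.exp (-ε * supNorm (y - x)) / nrm (y - x) ^ a)
        (by positivity) y (fun e => ?_) (hφ y)
      rw [← nrm_neg, neg_sub, ← supNorm_neg, neg_sub]; exact hA x y c e
    have h1 := abs_sum_mul_le_of_damped_profiles hd ha hb hab hκ hB hε S x u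
      (K := fun y => κ * Real.exp (-ε * supNorm (y - x)) / nrm (y - x) ^ a) (f := fun y => B * Real.exp (-ε * supNorm (y - u)) / nrm (y - u) ^ b)
      (fun y _ => by rw [abs_of_nonneg (by have := nrm_pos (y - x); positivity)])
      (fun y _ => by rw [abs_of_nonneg (by have := nrm_pos (y - u); positivity)])
    calc ∑ y ∈ S, |∑ e, A x y c e * φ y e|
        ≤ ∑ y ∈ S, Fintype.card F * (κ * Real.exp (-ε * supNorm (y - x)) / nrm (y - x) ^ a * (B * Real.exp (-ε * supNorm (y - u)) / nrm (y - u) ^ b)) :=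
          Finset.sum_le_sum hpt
      _ = Fintype.card F * ∑ y ∈ S, |κ * Real.exp (-ε * supNorm (y - x)) / nrm (y - x) ^ a * (B * Real.exp (-ε * supNorm (y - u)) / nrm (y - u) ^ b)| := by
          rw [Finset.mul_sum]
          refine Finset.sum_congr rfl fun y _ => ?_
          rw [abs_of_nonneg (by have := nrm_pos (y - x); have := nrm_pos (y - u); positivity)]
      _ ≤ Fintype.card F * (κ * B * (d * 2 ^ (d + 3) * 9 ^ (d - 1)) * Real.exp (-ε * supNorm (x - u)) / nrm (x - u) ^ (a + b - d)) :=
          mul_le_mul_of_nonneg_left h1 (Nat.cast_nonneg _)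
      _ = _ := by ring
  exact (summable_and_abs_tsum_le_of_abs_sum_le hS).2

/-- [folklore] **PAIRING OF TWO DAMPED PROFILES** (`a, b ≤ d−1`, `a+b ≥ d+1`): fibrewise `|ψ x c| ≤ κ·e^{−ε‖x−u‖∞}∕nrm(x−u)^a`,
`|χ x c| ≤ A·e^{−ε‖x−v‖∞}∕nrm(x−v)^b` ⇒ summable and `|pairing ψ χ| ≤ card F·κ·A·(d·2^{d+3}·9^{d−1})·e^{−ε‖u−v‖∞}∕nrm(u−v)^{a+b−d}`. -/
theorem abs_pairing_le_of_damped_profiles (hd : 0 < d) {a b : ℕ} (ha : a ≤ d - 1) (hb : b ≤ d - 1) (hab : d + 1 ≤ a + b)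
    {ψ χ : Site d → F → ℝ} {κ A ε : ℝ} (hκ : 0 ≤ κ) (hA : 0 ≤ A) (hε : 0 ≤ ε) (u v : Site d)
    (hψ : ∀ x c, |ψ x c| ≤ κ * Real.exp (-ε * supNorm (x - u)) / nrm (x - u) ^ a)
    (hχ : ∀ x c, |χ x c| ≤ A * Real.exp (-ε * supNorm (x - v)) / nrm (x - v) ^ b) :
    Summable (fun x => ∑ c, ψ x c * χ x c) ∧
      |pairing ψ χ| ≤ Fintype.card F * κ * A * (d * 2 ^ (d + 3) * 9 ^ (d - 1)) * Real.exp (-ε * supNorm (u - v)) / nrm (u - v) ^ (a + b - d) := by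
  have hS : ∀ S : Finset (Site d), ∑ x ∈ S, |∑ c, ψ x c * χ x c|
      ≤ Fintype.card F * κ * A * (d * 2 ^ (d + 3) * 9 ^ (d - 1)) * Real.exp (-ε * supNorm (u - v)) / nrm (u - v) ^ (a + b - d) := by
    intro S
    have hpt : ∀ x ∈ S, |∑ c, ψ x c * χ x c| ≤ Fintype.card F *
        (κ * Real.exp (-ε * supNorm (x - u)) / nrm (x - u) ^ a * (A * Real.exp (-ε * supNorm (x - v)) / nrm (x - v) ^ b)) := by
      intro x _
      have := nrm_pos (x - u)
      exact abs_sum_fibre_mul_le (by positivity) x (hψ x) (hχ x)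
    have h1 := abs_sum_mul_le_of_damped_profiles hd ha hb hab hκ hA hε S u v
      (K := fun x => κ * Real.exp (-ε * supNorm (x - u)) / nrm (x - u) ^ a) (f := fun x => A * Real.exp (-ε * supNorm (x - v)) / nrm (x - v) ^ b)
      (fun x _ => by rw [abs_of_nonneg (by have := nrm_pos (x - u); positivity)])
      (fun x _ => by rw [abs_of_nonneg (by have := nrm_pos (x - v); positivity)])
    calc ∑ x ∈ S, |∑ c, ψ x c * χ x c|
        ≤ ∑ x ∈ S, Fintype.card F * (κ * Real.exp (-ε * supNorm (x - u)) / nrm (x - u) ^ a * (A * Real.exp (-ε * supNorm (x - v)) / nrm (x - v) ^ b)) :=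
          Finset.sum_le_sum hpt
      _ = Fintype.card F * ∑ x ∈ S, |κ * Real.exp (-ε * supNorm (x - u)) / nrm (x - u) ^ a * (A * Real.exp (-ε * supNorm (x - v)) / nrm (x - v) ^ b)| := by
          rw [Finset.mul_sum]
          refine Finset.sum_congr rfl fun x _ => ?_
          rw [abs_of_nonneg (by have := nrm_pos (x - u); have := nrm_pos (x - v); positivity)]
      _ ≤ Fintype.card F * (κ * A * (d * 2 ^ (d + 3) * 9 ^ (d - 1)) * Real.exp (-ε * supNorm (u - v)) / nrm (u - v) ^ (a + b - d)) :=
          mul_le_mul_of_nonneg_left h1 (Nat.cast_nonneg _)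
      _ = _ := by ring
  have h := summable_and_abs_tsum_le_of_abs_sum_le hS
  exact ⟨h.1, by rw [pairing_def]; exact h.2⟩

/-! ## §3 Flat × Coulomb, damped: the flat factor's damping is split, half to the centres, half summed -/

/-- [folklore] **DAMPED FLAT × DAMPED COULOMB** (`a ≤ d−1`; `κ, B ≥ 0`, `ε > 0`): `|K x| ≤ κ·e^{−ε‖x−u‖∞}∕nrm(x−u)^a` and a FLAT damped
factor `|f x| ≤ B·e^{−ε‖x−v‖∞}` give `Σ_{x∈S}|K x·f x| ≤ κ·B·e^{−(ε∕2)‖u−v‖∞}·(1 + 2d·3^{d−1}·((d−1−a)!·(2∕(ε∕2))^{d−1−a}·(1+2∕(ε∕2))))` (half of each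
damping to the centre distance, the other half of `K`'s summed by part 1 at rate `ε∕2`; at `ε = δ∕n` the bracket is `C·n^{d−a}`). -/
theorem abs_sum_mul_le_of_damped_flat (hd : 0 < d) {a : ℕ} (ha : a ≤ d - 1) {K f : Site d → ℝ} {κ B ε : ℝ} (hκ : 0 ≤ κ) (hB : 0 ≤ B)
    (hε : 0 < ε) (S : Finset (Site d)) (u v : Site d)
    (hK : ∀ x ∈ S, |K x| ≤ κ * Real.exp (-ε * supNorm (x - u)) / nrm (x - u) ^ a)
    (hf : ∀ x ∈ S, |f x| ≤ B * Real.exp (-ε * supNorm (x - v))) :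
    ∑ x ∈ S, |K x * f x| ≤ κ * B * Real.exp (-(ε / 2) * supNorm (u - v)) *
      (1 + 2 * d * 3 ^ (d - 1) * ((d - 1 - a).factorial * (2 / (ε / 2)) ^ (d - 1 - a) * (1 + 2 / (ε / 2)))) := by
  have hε2 : (0 : ℝ) ≤ ε / 2 := by positivity
  have hpt : ∀ x ∈ S, |K x * f x| ≤ κ * B * Real.exp (-(ε / 2) * supNorm (u - v)) *
      (Real.exp (-(ε / 2) * supNorm (x - u)) / nrm (x - u) ^ a) := by
    intro x hx
    have h1 := nrm_pos (x - u)
    have htri := exp_mul_exp_le_exp_of_triangle hε2 x u v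
    have hle1 : Real.exp (-(ε / 2) * supNorm (x - v)) ≤ 1 := by
      rw [Real.exp_le_one_iff]; have : (0 : ℝ) ≤ ε / 2 * supNorm (x - v) := by positivity
      linarith
    rw [abs_mul]
    calc |K x| * |f x| ≤ κ * Real.exp (-ε * supNorm (x - u)) / nrm (x - u) ^ a * (B * Real.exp (-ε * supNorm (x - v))) :=
          mul_le_mul (hK x hx) (hf x hx) (abs_nonneg _) (by positivity)
      _ = κ * B * (Real.exp (-(ε / 2) * supNorm (x - u)) * Real.exp (-(ε / 2) * supNorm (x - v))) *
            Real.exp (-(ε / 2) * supNorm (x - v)) * (Real.exp (-(ε / 2) * supNorm (x - u)) / nrm (x - u) ^ a) := by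
          rw [exp_neg_eq_half_mul_half ε (supNorm (x - u) : ℝ), exp_neg_eq_half_mul_half ε (supNorm (x - v) : ℝ)]
          field_simp
      _ ≤ κ * B * Real.exp (-(ε / 2) * supNorm (u - v)) * 1 * (Real.exp (-(ε / 2) * supNorm (x - u)) / nrm (x - u) ^ a) := by
          gcongr
      _ = _ := by rw [mul_one]
  calc ∑ x ∈ S, |K x * f x| ≤ ∑ x ∈ S, κ * B * Real.exp (-(ε / 2) * supNorm (u - v)) * (Real.exp (-(ε / 2) * supNorm (x - u)) / nrm (x - u) ^ a) :=
        Finset.sum_le_sum hpt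
    _ = κ * B * Real.exp (-(ε / 2) * supNorm (u - v)) * ∑ x ∈ S, Real.exp (-(ε / 2) * supNorm (x - u)) / nrm (x - u) ^ a := by
        rw [Finset.mul_sum]
    _ ≤ _ := mul_le_mul_of_nonneg_left (sum_exp_div_nrm_pow_le hd (by positivity) ha S u) (by positivity)

/-- [folklore] **FLAT-DAMPED BOND FUNCTION THROUGH A DAMPED COULOMB LEG** (`a ≤ d−1`): `|A x y c e| ≤ κ·e^{−ε‖x−y‖∞}∕nrm(x−y)^a`,
`|φ y e| ≤ B·e^{−ε‖y−u‖∞}` ⇒ `|applyK A φ x c| ≤ card F·κ·B·e^{−(ε∕2)‖x−u‖∞}·(1 + 2d·3^{d−1}((d−1−a)!(2∕(ε∕2))^{d−1−a}(1+2∕(ε∕2))))` — the output is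
FLAT, damped at half the rate (at `ε = δ∕n`, `a = 2`, `d = 4`: the block-smooth `Ga∇P`-type point values `∝ n²·B`). -/
theorem abs_applyK_le_of_damped_flat (hd : 0 < d) {a : ℕ} (ha : a ≤ d - 1) {A : MKer d F} {φ : Site d → F → ℝ} {κ B ε : ℝ} (hκ : 0 ≤ κ)
    (hB : 0 ≤ B) (hε : 0 < ε) (u : Site d) (hA : ∀ x y c e, |A x y c e| ≤ κ * Real.exp (-ε * supNorm (x - y)) / nrm (x - y) ^ a)
    (hφ : ∀ y e, |φ y e| ≤ B * Real.exp (-ε * supNorm (y - u))) (x : Site d) (c : F) :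
    |applyK A φ x c| ≤ Fintype.card F * κ * B * Real.exp (-(ε / 2) * supNorm (x - u)) *
      (1 + 2 * d * 3 ^ (d - 1) * ((d - 1 - a).factorial * (2 / (ε / 2)) ^ (d - 1 - a) * (1 + 2 / (ε / 2)))) := by
  rw [applyK_apply]
  have hS : ∀ S : Finset (Site d), ∑ y ∈ S, |∑ e, A x y c e * φ y e| ≤ Fintype.card F * κ * B * Real.exp (-(ε / 2) * supNorm (x - u)) *
      (1 + 2 * d * 3 ^ (d - 1) * ((d - 1 - a).factorial * (2 / (ε / 2)) ^ (d - 1 - a) * (1 + 2 / (ε / 2)))) := by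
    intro S
    have hpt : ∀ y ∈ S, |∑ e, A x y c e * φ y e| ≤ Fintype.card F *
        (κ * Real.exp (-ε * supNorm (y - x)) / nrm (y - x) ^ a * (B * Real.exp (-ε * supNorm (y - u)))) := by
      intro y _
      have := nrm_pos (y - x)
      refine abs_sum_fibre_mul_le (ψ := fun y e => A x y c e) (P := κ * Real.exp (-ε * supNorm (y - x)) / nrm (y - x) ^ a)
        (by positivity) y (fun e => ?_) (hφ y)
      rw [← nrm_neg, neg_sub, ← supNorm_neg, neg_sub]; exact hA x y c e
    have h1 := abs_sum_mul_le_of_damped_flat hd ha hκ hB hε S x u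
      (K := fun y => κ * Real.exp (-ε * supNorm (y - x)) / nrm (y - x) ^ a) (f := fun y => B * Real.exp (-ε * supNorm (y - u)))
      (fun y _ => by rw [abs_of_nonneg (by have := nrm_pos (y - x); positivity)]) (fun y _ => by rw [abs_of_nonneg (by positivity)])
    calc ∑ y ∈ S, |∑ e, A x y c e * φ y e|
        ≤ ∑ y ∈ S, Fintype.card F * (κ * Real.exp (-ε * supNorm (y - x)) / nrm (y - x) ^ a * (B * Real.exp (-ε * supNorm (y - u)))) :=
          Finset.sum_le_sum hpt
      _ = Fintype.card F * ∑ y ∈ S, |κ * Real.exp (-ε * supNorm (y - x)) / nrm (y - x) ^ a * (B * Real.exp (-ε * supNorm (y - u)))| := by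
          rw [Finset.mul_sum]
          refine Finset.sum_congr rfl fun y _ => ?_
          rw [abs_of_nonneg (by have := nrm_pos (y - x); positivity)]
      _ ≤ _ := by
          refine (mul_le_mul_of_nonneg_left h1 (Nat.cast_nonneg _)).trans (le_of_eq ?_); ring
  exact (summable_and_abs_tsum_le_of_abs_sum_le hS).2

/-- [folklore] **PAIRING, DAMPED COULOMB × DAMPED FLAT** (`a ≤ d−1`): fibrewise `|ψ x c| ≤ κ·e^{−ε‖x−u‖∞}∕nrm(x−u)^a`, `|χ x c| ≤ B·e^{−ε‖x−v‖∞}` ⇒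
summable and `|pairing ψ χ| ≤ card F·κ·B·e^{−(ε∕2)‖u−v‖∞}·(1 + 2d·3^{d−1}((d−1−a)!(2∕(ε∕2))^{d−1−a}(1+2∕(ε∕2))))`. -/
theorem abs_pairing_le_of_damped_flat (hd : 0 < d) {a : ℕ} (ha : a ≤ d - 1) {ψ χ : Site d → F → ℝ} {κ B ε : ℝ} (hκ : 0 ≤ κ) (hB : 0 ≤ B)
    (hε : 0 < ε) (u v : Site d) (hψ : ∀ x c, |ψ x c| ≤ κ * Real.exp (-ε * supNorm (x - u)) / nrm (x - u) ^ a)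
    (hχ : ∀ x c, |χ x c| ≤ B * Real.exp (-ε * supNorm (x - v))) :
    Summable (fun x => ∑ c, ψ x c * χ x c) ∧ |pairing ψ χ| ≤ Fintype.card F * κ * B * Real.exp (-(ε / 2) * supNorm (u - v)) *
      (1 + 2 * d * 3 ^ (d - 1) * ((d - 1 - a).factorial * (2 / (ε / 2)) ^ (d - 1 - a) * (1 + 2 / (ε / 2)))) := by
  have hS : ∀ S : Finset (Site d), ∑ x ∈ S, |∑ c, ψ x c * χ x c| ≤ Fintype.card F * κ * B * Real.exp (-(ε / 2) * supNorm (u - v)) *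
      (1 + 2 * d * 3 ^ (d - 1) * ((d - 1 - a).factorial * (2 / (ε / 2)) ^ (d - 1 - a) * (1 + 2 / (ε / 2)))) := by
    intro S
    have hpt : ∀ x ∈ S, |∑ c, ψ x c * χ x c| ≤ Fintype.card F *
        (κ * Real.exp (-ε * supNorm (x - u)) / nrm (x - u) ^ a * (B * Real.exp (-ε * supNorm (x - v)))) := by
      intro x _
      have := nrm_pos (x - u)
      exact abs_sum_fibre_mul_le (by positivity) x (hψ x) (hχ x)
    have h1 := abs_sum_mul_le_of_damped_flat hd ha hκ hB hε S u v
      (K := fun x => κ * Real.exp (-ε * supNorm (x - u)) / nrm (x - u) ^ a) (f := fun x => B * Real.exp (-ε * supNorm (x - v)))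
      (fun x _ => by rw [abs_of_nonneg (by have := nrm_pos (x - u); positivity)]) (fun x _ => by rw [abs_of_nonneg (by positivity)])
    calc ∑ x ∈ S, |∑ c, ψ x c * χ x c|
        ≤ ∑ x ∈ S, Fintype.card F * (κ * Real.exp (-ε * supNorm (x - u)) / nrm (x - u) ^ a * (B * Real.exp (-ε * supNorm (x - v)))) :=
          Finset.sum_le_sum hpt
      _ = Fintype.card F * ∑ x ∈ S, |κ * Real.exp (-ε * supNorm (x - u)) / nrm (x - u) ^ a * (B * Real.exp (-ε * supNorm (x - v)))| := by
          rw [Finset.mul_sum]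
          refine Finset.sum_congr rfl fun x _ => ?_
          rw [abs_of_nonneg (by have := nrm_pos (x - u); positivity)]
      _ ≤ _ := by
          refine (mul_le_mul_of_nonneg_left h1 (Nat.cast_nonneg _)).trans (le_of_eq ?_); ring
  have h := summable_and_abs_tsum_le_of_abs_sum_le hS
  exact ⟨h.1, by rw [pairing_def]; exact h.2⟩

/-! ## §4 Flat × flat, damped -/

/-- [folklore] **TWO FLAT DAMPED FACTORS**: `|K x| ≤ κ·e^{−ε‖x−u‖∞}`, `|f x| ≤ B·e^{−ε‖x−v‖∞}` (`ε > 0`) ⇒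
`Σ_{x∈S}|K x·f x| ≤ κ·B·e^{−(ε∕2)‖u−v‖∞}·(1 + 2d·3^{d−1}((d−1)!(2∕(ε∕2))^{d−1}(1+2∕(ε∕2))))` (at `ε = δ∕n`: `C·n^d`). -/
theorem abs_sum_mul_le_of_flat_flat (hd : 0 < d) {K f : Site d → ℝ} {κ B ε : ℝ} (hκ : 0 ≤ κ) (hB : 0 ≤ B) (hε : 0 < ε) (S : Finset (Site d))
    (u v : Site d) (hK : ∀ x ∈ S, |K x| ≤ κ * Real.exp (-ε * supNorm (x - u))) (hf : ∀ x ∈ S, |f x| ≤ B * Real.exp (-ε * supNorm (x - v))) :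
    ∑ x ∈ S, |K x * f x| ≤ κ * B * Real.exp (-(ε / 2) * supNorm (u - v)) *
      (1 + 2 * d * 3 ^ (d - 1) * ((d - 1 - 0).factorial * (2 / (ε / 2)) ^ (d - 1 - 0) * (1 + 2 / (ε / 2)))) :=
  abs_sum_mul_le_of_damped_flat hd (a := 0) (Nat.zero_le _) hκ hB hε S u v
    (fun x hx => by rw [pow_zero, div_one]; exact hK x hx) hf

end Summit.QuantumFields.BalabanUV.Beta.D1BFx.LatticeHLSDamped
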